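import Summits.CriticalPhenomena.CardyFormulaZ2.Theorems.CardySusyWardParafermionFamiliesToSLESixAnchoredWallFluxWall
import Summits.CriticalPhenomena.CardyFormulaZ2.Theorems.CardySusyWardParafermionFamiliesToSLESixAnchoredWallFluxSupport
import Summits.CriticalPhenomena.CardyFormulaZ2.Theorems.CardySusyWardParafermionFamiliesToSLESixAnchorGeometry
import Literature.Probability.LatticeModels.InnerFacesHoleFree

/-!
# The strip anchor (stub S5 of line `strip-anchored-vertex-normalisation`, crux stmt-CriticalPhenomena-10814):
# ASSEMBLY — `IkhlefPonsaingFirstPassage → AnchoredWallFlux`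

The conditional form of stub S5 (`stub_anchoredWallFlux_of_IP`, registered): Ikhlef–Ponsaing's exact strip
passage law (the named fact `Literature.Probability.Percolation.IkhlefPonsaingFirstPassage`, IP12 Prop. 4.7)
implies the strip anchor `AnchoredWallFlux` of `…Defs.lean` — some Dobrushin domain with a discretisation family,
a straight piece of free wall and `c > 0` such that for `χ = ±i` and every box height `0 < h < r`, eventually in
the mesh `δ`, the wall flux of the corner observable out of the box `wallBox w₀ n r h` is `≥ c δ^{-2/3}`.

Witnesses: the ANCHOR Dobrushin domain `anchorDomain` of `…AnchorFamily.lean` (the diagonal square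
`{|x+y| < 2, |x-y| < 2}` whose free arc is the side `{x + y = 2}`), any discretisation family of it
(`S5.exists_isFamily_anchor`), the wall point `w₀ = 1 + i`, the inward normal `n = -(1+i)/√2`, `r = 1/8`
(`S5.localHalfPlane_anchor`), and `c/128` for the constant `c` of the touch-probability bound `S5.touchProb_lower`.

Proof (composition of the landed pieces). Eventually in `δ` the lattice geometry of `Λ δ` is the explicit
diamond of size `L`, `L δ < 2 ≤ (L+1) δ` (`S5.anchor_geometry`); for `δ < min (h/4) (1/(L₀ + 40))`:
* every wall site `w` (level `L - 2`, column `2|d| ≤ L + 2`) is joined to the wired arc with probability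
  `P w ≥ c L^{-1/3} > 0` (`S5.touchProb_lower`), so these events are nonempty and the WALL PACKAGE
  `S5.wall_phase_package` (`…AnchoredWallFluxWall.lean`; hole-freeness of the inner faces from
  `holeFree_innerFaces` on the Jordan domain of the anchor) evaluates the two flux darts of every such `w` as
  `sixthPhase (τ ± 1) · P w` with ONE winding class `τ`;
* in the level / column coordinates of the box (`S5.mem_wallBox_anchor_iff`, `S5.medialPoint_level_column`)
  the window only sees medial vertices of column `2|d| ≤ L` and level `≥ 0` (`S5.anchor_band`), so the SUPPORT
  bound `S5.norm_wallFlux_ge` gives `‖wallFlux‖ ≥ (√3/2) Σ_{w ∈ W} P w` for the window `W` of the `2⌊1/(32δ)⌋ + 1`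
  central wall sites, whose outgoing darts lie in the box (`S5.anchor_window`);
* numerics (`S5.anchor_numerics`): `card W ≥ 1/(32 δ)`, `L^{-1/3} ≥ (δ/8)^{1/3} = δ^{1/3}/2` (`L ≤ 8/δ`), so
  `(√3/2) · card W · c L^{-1/3} ≥ (c/128) δ^{-2/3}`.
-/

noncomputable section

namespace Summit.CriticalPhenomena.CardyFormulaZ2.Theorems.ParafermionFamiliesToSLESix.StripAnchored

open MeasureTheory Filter Set Metric Complex
open scoped Topology BigOperators
open Literature.Probability.LatticeModels
open Literature.Probability.Percolation (bondPercolation half BondConfig)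
open Literature.Barriers.CriticalPhenomena (medialVertexOf)
open Summit.CriticalPhenomena.CardyFormulaZ2.Cruxes.EdgePrecompact.QkzStripBoundaryArm (cornerObs)
open S2 (sixthPhase)

namespace S5

/-! ## Coordinates of the wall box of the anchor -/

/-- The normal and tangential coordinates of the anchor's wall box at `w₀ = 1 + i`, `n = -(1+i)/√2`:
`Re((z - w₀)·n̄) = (2 - (re z + im z))/√2` and `Re((z - w₀)·conj(i n)) = (re z - im z)/√2`. [folklore] -/
theorem wallBox_anchor_coords (z : ℂ) :
    ((z - (1 + I)) * (starRingEnd ℂ) (-(1 + I) / (Real.sqrt 2 : ℂ))).re = (2 - (z.re + z.im)) / Real.sqrt 2 ∧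
    ((z - (1 + I)) * (starRingEnd ℂ) (I * (-(1 + I) / (Real.sqrt 2 : ℂ)))).re = (z.re - z.im) / Real.sqrt 2 := by
  have hconj : (starRingEnd ℂ) (-(1 + I) / (Real.sqrt 2 : ℂ)) = -(1 - I) / (Real.sqrt 2 : ℂ) := by
    rw [map_div₀, map_neg, map_add, map_one, Complex.conj_I, Complex.conj_ofReal, sub_eq_add_neg]
  have hconj' : (starRingEnd ℂ) (I * (-(1 + I) / (Real.sqrt 2 : ℂ))) = (1 + I) / (Real.sqrt 2 : ℂ) := by
    rw [map_mul, hconj, Complex.conj_I]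
    have : (-I) * (-(1 - I)) = 1 + I := by
      rw [show (-I) * (-(1 - I)) = I - I * I by ring, Complex.I_mul_I]; ring
    rw [← mul_div_assoc, this]
  constructor
  · rw [hconj, ← mul_div_assoc, Complex.div_ofReal_re]
    congr 1
    simp; ring
  · rw [hconj', ← mul_div_assoc, Complex.div_ofReal_re]
    congr 1
    simp

/-- Membership in the anchor's wall box `wallBox (1+i) (-(1+i)/√2) (1/8) h` in level / column coordinates:
`|re z - im z| < √2/8` and `|2 - (re z + im z)| < √2 h`. [folklore] -/
theorem mem_wallBox_anchor_iff {z : ℂ} {h : ℝ} :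
    z ∈ wallBox (1 + I) (-(1 + I) / (Real.sqrt 2 : ℂ)) (1 / 8) h ↔
      |z.re - z.im| < Real.sqrt 2 / 8 ∧ |2 - (z.re + z.im)| < Real.sqrt 2 * h := by
  have hs : (0:ℝ) < Real.sqrt 2 := Real.sqrt_pos.2 (by norm_num)
  obtain ⟨h1, h2⟩ := wallBox_anchor_coords z
  simp only [wallBox, Set.mem_setOf_eq, h1, h2, abs_div, abs_of_pos hs, div_lt_iff₀ hs]
  constructor
  · rintro ⟨ha, hb⟩; exact ⟨by linarith, by linarith⟩
  · rintro ⟨ha, hb⟩; exact ⟨by linarith, by linarith⟩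

/-- Level and column of the medial point of the medial vertex `s(x, x + eᵢ)` at mesh `δ`:
`re + im = δ (s + 1/2)`, `re - im = δ (d ± 1/2)` (`s = x₀ + x₁`, `d = x₀ - x₁`, sign `+` for `i = 0`). [folklore] -/
theorem medialPoint_level_column (δ : ℝ) (x : Site 2) (i : Fin 2) :
    (medialPoint δ (medialVertexOf (x, i))).re + (medialPoint δ (medialVertexOf (x, i))).im =
        δ * ((x 0 : ℝ) + x 1) + δ / 2 ∧
      (medialPoint δ (medialVertexOf (x, i))).re - (medialPoint δ (medialVertexOf (x, i))).im =
        δ * ((x 0 : ℝ) - x 1) + (if i = 0 then δ / 2 else -(δ / 2)) := by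
  fin_cases i <;> simp [medialVertexOf, medialPoint_mk] <;> constructor <;> ring

/-- The two coordinates of the medial point of the OUTGOING flux dart `s(w - e₀, w)` of a wall site `w`:
level `δ (s - 1/2)` and column `δ (d - 1/2)`. [folklore] -/
theorem medialPoint_wallDart (δ : ℝ) (w : Site 2) :
    (medialPoint δ (medialVertexOf (w - cornerUnit 0, (0 : Fin 2)))).re +
        (medialPoint δ (medialVertexOf (w - cornerUnit 0, (0 : Fin 2)))).im = δ * ((w 0 : ℝ) + w 1) - δ / 2 ∧
      (medialPoint δ (medialVertexOf (w - cornerUnit 0, (0 : Fin 2)))).re -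
        (medialPoint δ (medialVertexOf (w - cornerUnit 0, (0 : Fin 2)))).im = δ * ((w 0 : ℝ) - w 1) - δ / 2 := by
  obtain ⟨h1, h2⟩ := medialPoint_level_column δ (w - cornerUnit 0) 0
  rw [h1, h2]
  simp [cornerUnit]
  constructor <;> ring

/-- `√2 < 3/2` and `1 ≤ √2`. [folklore] -/
private theorem sqrt_two_bounds : Real.sqrt 2 < 3 / 2 ∧ 1 ≤ Real.sqrt 2 :=
  ⟨by nlinarith [Real.sq_sqrt (show (0:ℝ) ≤ 2 by norm_num), Real.sqrt_nonneg 2],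
    Real.one_le_sqrt.2 (by norm_num)⟩

/-! ## The band seen by the window, the window of wall sites, the numerics -/

/-- **The band hypothesis `hU`.** At mesh `δ < 1/40` with `2 ≤ (L + 1) δ`, a medial vertex whose medial point
lies in the wall box `wallBox (1+i) (-(1+i)/√2) (1/8) h`, `h < 1/8`, has column `2|d| ≤ L` and level `s ≥ 0`.
[folklore] -/
theorem anchor_band {δ : ℝ} (hδ0 : 0 < δ) (hδs : δ < 1 / 40) {L : ℤ} (hL1 : 2 ≤ ((L : ℝ) + 1) * δ)
    {h : ℝ} (hh : 0 < h) (hh8 : h < 1 / 8) (p : Site 2 × Fin 2)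
    (hp : medialPoint δ (medialVertexOf p) ∈ wallBox (1 + I) (-(1 + I) / (Real.sqrt 2 : ℂ)) (1 / 8) h) :
    2 * |p.1 0 - p.1 1| ≤ L ∧ 0 ≤ p.1 0 + p.1 1 := by
  obtain ⟨x, i⟩ := p
  obtain ⟨hs2, hs1⟩ := sqrt_two_bounds
  rw [mem_wallBox_anchor_iff] at hp
  obtain ⟨hT, hN⟩ := hp
  obtain ⟨hlev, hcol⟩ := medialPoint_level_column δ x i
  rw [hcol] at hT
  rw [hlev] at hN
  dsimp only
  constructor
  · have hT' : |δ * ((x 0 : ℝ) - x 1)| < Real.sqrt 2 / 8 + δ / 2 := by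
      split_ifs at hT <;> (rw [abs_lt] at hT ⊢; constructor <;> linarith)
    rw [abs_mul, abs_of_pos hδ0] at hT'
    have hlt : δ * (2 * |(x 0 : ℝ) - x 1|) < δ * (L : ℝ) := by nlinarith
    have hlt' := lt_of_mul_lt_mul_left hlt hδ0.le
    have : (2 * |x 0 - x 1| : ℤ) < L := by exact_mod_cast hlt'
    exact this.le
  · rw [abs_lt] at hN
    have hsh : Real.sqrt 2 * h < 3 / 16 := by nlinarith
    have hlt : δ * 0 < δ * ((x 0 : ℝ) + x 1) := by nlinarith
    have hlt' := lt_of_mul_lt_mul_left hlt hδ0.le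
    have : (0 : ℤ) < x 0 + x 1 := by exact_mod_cast hlt'
    exact this.le

/-- **The window `W` of wall sites.** At mesh `δ < 1/40`, `δ < h/4`, with `L δ < 2 ≤ (L + 1) δ`: the wall sites
`(L - 2 - t, t)`, `|t - (L-2)/2| ≤ ⌊1/(32δ)⌋`, number at least `1/(32 δ)`, lie in the harm window `2|d| ≤ L + 2`,
and their outgoing flux darts have medial points in the wall box `wallBox (1+i) (-(1+i)/√2) (1/8) h`. [folklore] -/
theorem anchor_window {δ : ℝ} (hδ0 : 0 < δ) (hδs : δ < 1 / 40) {L : ℤ} (hLδ : (L : ℝ) * δ < 2)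
    (hL1 : 2 ≤ ((L : ℝ) + 1) * δ) {h : ℝ} (hh : 0 < h) (hδh : δ < h / 4) :
    ∃ W : Finset (Site 2), 1 / (32 * δ) ≤ (W.card : ℝ) ∧
      ∀ w ∈ W, w 0 + w 1 = L - 2 ∧ 2 * |w 0 - w 1| ≤ L + 2 ∧
        medialPoint δ (medialVertexOf (w - cornerUnit 0, (0 : Fin 2))) ∈
          wallBox (1 + I) (-(1 + I) / (Real.sqrt 2 : ℂ)) (1 / 8) h := by
  obtain ⟨hs2, hs1⟩ := sqrt_two_bounds
  set m : ℤ := (L - 2) / 2 with hm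
  have hm2 : L - 2 - 2 * m = 0 ∨ L - 2 - 2 * m = 1 := by omega
  set M : ℕ := ⌊1 / (32 * δ)⌋₊ with hM
  have hM1 : (M : ℝ) ≤ 1 / (32 * δ) := Nat.floor_le (by positivity)
  have hM2 : 1 / (32 * δ) < M + 1 := Nat.lt_floor_add_one _
  have hMδ : δ * M ≤ 1 / 32 := by
    rw [le_div_iff₀ (by positivity)] at hM1
    linarith
  have hq1 : 1 ≤ 1 / (32 * δ) := by
    rw [le_div_iff₀ (by positivity)]
    linarith
  refine ⟨(Finset.Icc (m - M) (m + M)).image (fun t : ℤ => (![L - 2 - t, t] : Site 2)), ?_, ?_⟩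
  · rw [Finset.card_image_of_injective _ (fun t t' htt => by simpa using congr_fun htt 1), Int.card_Icc,
      show m + M + 1 - (m - M) = ((2 * M + 1 : ℕ) : ℤ) by push_cast; ring, Int.toNat_natCast]
    push_cast
    linarith
  · intro w hw
    obtain ⟨t, ht, rfl⟩ := Finset.mem_image.1 hw
    rw [Finset.mem_Icc] at ht
    have hws : (![L - 2 - t, t] : Site 2) 0 + (![L - 2 - t, t] : Site 2) 1 = L - 2 := by simp
    have hwd : |(![L - 2 - t, t] : Site 2) 0 - (![L - 2 - t, t] : Site 2) 1| ≤ 2 * M + 1 := by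
      simp only [Matrix.cons_val_zero, Matrix.cons_val_one, Matrix.cons_val_fin_one]
      rw [abs_le]
      omega
    have h4M : (4 * M : ℤ) < L := by
      have hlt : δ * (4 * (M : ℝ)) < δ * (L : ℝ) := by nlinarith
      exact_mod_cast lt_of_mul_lt_mul_left hlt hδ0.le
    refine ⟨hws, ?_, ?_⟩
    · have := abs_nonneg ((![L - 2 - t, t] : Site 2) 0 - (![L - 2 - t, t] : Site 2) 1)
      omega
    · rw [mem_wallBox_anchor_iff]
      obtain ⟨hlev, hcol⟩ := medialPoint_wallDart δ (![L - 2 - t, t] : Site 2)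
      rw [hcol, hlev]
      have hws' : ((![L - 2 - t, t] : Site 2) 0 : ℝ) + ((![L - 2 - t, t] : Site 2) 1 : ℝ) = L - 2 := by
        exact_mod_cast hws
      have hwd' : |((![L - 2 - t, t] : Site 2) 0 : ℝ) - ((![L - 2 - t, t] : Site 2) 1 : ℝ)| ≤ 2 * M + 1 := by
        exact_mod_cast hwd
      rw [abs_le] at hwd'
      obtain ⟨hd1, hd2⟩ := hwd'
      constructor
      · rw [abs_lt]
        constructor <;> nlinarith
      · rw [hws', abs_lt]
        constructor <;> nlinarith

/-- **The numerics.** With `N ≥ 1/(32 δ)` wall sites each of touch probability `≥ c L^{-1/3}`, `L δ < 2`: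
`(c/128) δ^{-2/3} ≤ (√3/2) · S` for any `S ≥ N · c L^{-1/3}`. [folklore] -/
theorem anchor_numerics {δ c : ℝ} (hδ0 : 0 < δ) (hc : 0 ≤ c) {L : ℤ} (hL : 0 < L) (hLδ : (L : ℝ) * δ < 2)
    {N S : ℝ} (hN : 1 / (32 * δ) ≤ N) (hS : N * (c * (L : ℝ) ^ (-(1:ℝ) / 3)) ≤ S) :
    c / 128 * δ ^ (-(2:ℝ) / 3) ≤ Real.sqrt 3 / 2 * S := by
  have hLpos : (0:ℝ) < L := by exact_mod_cast hL
  have hpow1 : δ ^ ((1:ℝ) / 3) / 2 ≤ (L : ℝ) ^ (-(1:ℝ) / 3) := by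
    have h8 : (L : ℝ) ≤ (δ / 8)⁻¹ := by
      rw [inv_div, le_div_iff₀ hδ0]
      linarith
    refine le_trans (le_of_eq ?_) (stub_anchor_touchprob (δ / 8) (by positivity) L hLpos h8)
    rw [Real.div_rpow hδ0.le (by norm_num)]
    congr 1
    rw [show (8:ℝ) = 2 ^ (3:ℝ) by norm_num, ← Real.rpow_mul (by norm_num)]
    norm_num
  have hpow2 : δ ^ (-(2:ℝ) / 3) = δ⁻¹ * δ ^ ((1:ℝ) / 3) := by
    rw [show -(2:ℝ) / 3 = -1 + 1 / 3 by norm_num, Real.rpow_add hδ0, Real.rpow_neg_one]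
  have hinv : δ⁻¹ ≤ 32 * N := by
    have : δ⁻¹ = 32 * (1 / (32 * δ)) := by field_simp
    rw [this]
    exact mul_le_mul_of_nonneg_left hN (by norm_num)
  have hN0 : 0 ≤ N := le_trans (by positivity) hN
  have h3 : (1:ℝ) ≤ Real.sqrt 3 := Real.one_le_sqrt.2 (by norm_num)
  have hS0 : 0 ≤ N * (c * (L : ℝ) ^ (-(1:ℝ) / 3)) := by positivity
  calc c / 128 * δ ^ (-(2:ℝ) / 3) = c / 128 * (δ⁻¹ * δ ^ ((1:ℝ) / 3)) := by rw [hpow2]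
    _ ≤ c / 128 * ((32 * N) * (2 * (L : ℝ) ^ (-(1:ℝ) / 3))) := by
        refine mul_le_mul_of_nonneg_left (mul_le_mul hinv (by linarith) (by positivity) (by positivity)) ?_
        positivity
    _ = 1 / 2 * (N * (c * (L : ℝ) ^ (-(1:ℝ) / 3))) := by ring
    _ ≤ Real.sqrt 3 / 2 * S := mul_le_mul (by linarith) hS hS0 (by positivity)

end S5

open S5 in
/-- **Registered stub `stub_anchoredWallFlux_of_IP` (S5, conditional form): Ikhlef–Ponsaing's strip law implies the
strip anchor `AnchoredWallFlux`.** Witnesses: the anchor Dobrushin domain (diagonal square with the free side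
`{x + y = 2}`), its discretisation family (`exists_isFamily_anchor`), the wall point `1 + i`, inward normal
`-(1+i)/√2`, `r = 1/8` (`localHalfPlane_anchor`). Eventually in `δ` (`anchor_geometry`): on the lattice diamond of
size `L = ⌈2/δ⌉ - 1` the touch probabilities of the wall sites are `≥ c L^{-1/3}` (`touchProb_lower`, hence the
touch events are nonempty), the two flux darts of every wall site in the window are `sixthPhase (τ ± 1) ·` touch
probability with ONE `τ` (`wall_phase_package`, hole-freeness from `holeFree_innerFaces`), the wall flux out of the
box `wallBox (1+i) n (1/8) h` is `≥ (√3/2) Σ_{w ∈ W}` touch probability (`norm_wallFlux_ge`, band `anchor_band`)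
over a window `W` of `≥ 1/(32δ)` wall sites (`anchor_window`), and `(1/(32δ)) · c L^{-1/3} ≥ (c/64) δ^{-2/3}`
(`anchor_numerics`). [folklore] -/
theorem stub_anchoredWallFlux_of_IP : Literature.Probability.Percolation.IkhlefPonsaingFirstPassage → AnchoredWallFlux := by
  intro hIP
  obtain ⟨c, hc, L₀, harm⟩ := touchProb_lower hIP
  obtain ⟨Λ, hΛ⟩ := exists_isFamily_anchor
  refine ⟨anchorDomain, Λ, hΛ, 1 + I, -(1 + I) / (Real.sqrt 2 : ℂ), 1 / 8,
    localHalfPlane_anchor (by norm_num) (by norm_num), c / 128, by positivity, ?_⟩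
  intro χ hχ h hh hhr
  have hδ₁ : (0:ℝ) < min (h / 4) (1 / ((L₀ : ℝ) + 40)) := by positivity
  filter_upwards [anchor_geometry hΛ, Ioo_mem_nhdsGT hδ₁] with δ hgeom hδI
  obtain ⟨hδ0, hδ1⟩ := hδI
  obtain ⟨hδh, hδL⟩ := lt_min_iff.1 hδ1
  have hδs : δ < 1 / 40 := by
    refine lt_of_lt_of_le hδL ?_
    rw [div_le_div_iff_of_pos_left one_pos (by positivity) (by norm_num)]
    linarith [(Nat.cast_nonneg L₀ : (0:ℝ) ≤ L₀)]
  revert hgeom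
  generalize Λ δ = E
  rintro ⟨L, hL8, hLδ, hL1, hE, rfl, hΩ, hmesh, hadj, hbd, hface, harcB, harcA⟩
  -- `L ≥ L₀`
  have hL₀L : (L₀ : ℤ) ≤ L := by
    have hA : E.δ * ((L₀ : ℝ) + 40) < 1 := by
      rw [lt_div_iff₀ (by positivity)] at hδL
      linarith
    by_contra hlt
    have hle : (L : ℝ) + 1 ≤ L₀ := by exact_mod_cast (show L + 1 ≤ (L₀ : ℤ) by omega)
    have := mul_le_mul_of_nonneg_right hle hδ0.le
    nlinarith
  have hL0 : 0 < L := by omega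
  -- the touch events are nonempty; the wall package
  have hcL : 0 < c * (L : ℝ) ^ (-(1:ℝ) / 3) := by
    have : (0:ℝ) < L := by exact_mod_cast hL0
    positivity
  have hne : ∀ w : Site 2, w 0 + w 1 = L - 2 → 2 * |w 0 - w 1| ≤ L + 2 →
      ∃ ω : BondConfig (Site 2), ∃ a ∈ E.zdArcA, (SimpleGraph.fromEdgeSet (E.bcBondConfig ω)).Reachable w a := by
    intro w hw hdw
    obtain ⟨ω, hω⟩ := nonempty_of_measureReal_ne_zero
      (lt_of_lt_of_le hcL (harm E L hL₀L hE hmesh hadj hbd harcA w hw hdw)).ne'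
    exact ⟨ω, hω⟩
  have hH : HoleFree {f : Site 2 | E.IsInnerFace f} := holeFree_innerFaces anchorDomain.toJordanDomain hΩ hδ0
  obtain ⟨τ, hτ⟩ := wall_phase_package hE hH hL8 hmesh hadj hbd hface harcB hne
  obtain ⟨P, hP0, hPc, hout, hin⟩ : ∃ P : Site 2 → ℝ, (∀ w, 0 ≤ P w) ∧
      (∀ w : Site 2, w 0 + w 1 = L - 2 → 2 * |w 0 - w 1| ≤ L + 2 → c * (L : ℝ) ^ (-(1:ℝ) / 3) ≤ P w) ∧
      (∀ w : Site 2, w 0 + w 1 = L - 2 → 2 * |w 0 - w 1| ≤ L + 2 →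
        cornerObs E E.δ w (w - cornerUnit 0) = sixthPhase (τ + 1) * (P w : ℂ)) ∧
      (∀ w : Site 2, w 0 + w 1 = L - 2 → 2 * |w 0 - w 1| ≤ L + 2 →
        cornerObs E E.δ w (w - cornerUnit 1) = sixthPhase (τ - 1) * (P w : ℂ)) :=
    ⟨fun w => (bondPercolation (zdGraph 2) half).real
        {ω : BondConfig (Site 2) | ∃ a ∈ E.zdArcA, (SimpleGraph.fromEdgeSet (E.bcBondConfig ω)).Reachable w a},
      fun _ => measureReal_nonneg, fun w hw hdw => harm E L hL₀L hE hmesh hadj hbd harcA w hw hdw,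
      fun w hw hdw => (hτ w hw hdw).1, fun w hw hdw => (hτ w hw hdw).2⟩
  -- the band, the window, the flux bound, the numerics
  have hU := fun p hp => anchor_band hδ0 hδs hL1 hh (by linarith) p hp
  obtain ⟨W, hWcard, hW⟩ := anchor_window hδ0 hδs hLδ hL1 hh hδh
  have hflux := norm_wallFlux_ge hE hL8 hmesh hadj hbd hface hχ hU τ P hP0 hout hin W
    (fun w hw => ⟨(hW w hw).1, (hW w hw).2.2⟩)
  have hsum : (W.card : ℝ) * (c * (L : ℝ) ^ (-(1:ℝ) / 3)) ≤ ∑ w ∈ W, P w := by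
    rw [← nsmul_eq_mul]
    exact Finset.card_nsmul_le_sum W P _ fun w hw => hPc w (hW w hw).1 (hW w hw).2.1
  exact (anchor_numerics hδ0 hc.le hL0 hLδ hWcard hsum).trans hflux

end Summit.CriticalPhenomena.CardyFormulaZ2.Theorems.ParafermionFamiliesToSLESix.StripAnchored

end
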